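import Mathlib
import Literature.Analysis.FluidPDE.FluidComputer.ShellTransferIdentities
import HarnessLib

/-!
# The triad-CLASS ledger of a band's energy input: giver × mediator classes, their additivity, and why the
# SWEEPING class (giver and receiver both inside the band) nets to zero over the band while it is present pointwise

Cell `pub-fluidc` (FLUID COMPUTER; host summit `NavierStokesRegularity`, negation side, machine paradigm), prover seat p1
(gen 16, 2026-08-26). HONEST FRAMING: low prior, high value-of-information experiment on Tao's machine paradigm; NOT a claim
that NS blows up. Nothing in this file is about the Navier–Stokes EVOLUTION: like `Literature…ShellTransferIdentities` (on which
it builds) it is finite-sum algebra on an arbitrary real, incompressible field of Fourier coefficients `û : ℤ³ → ℂ³`, and it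
types the bookkeeping behind p1's LOCAL TRANSFER READ (instrument `r3spatial 0.2.0` / `transfer.py`; HOME/STATUS p1 gen 16;
deposit `atlas/rung-next/p1/spatial/transfer/`).

THE INSTRUMENT. For a target band `K` (the level-two band `[9,17)` of the relay designs) the instrument prints the local energy-input
density `t_K(x) = u_K · P_K P[u × ω](x)` split by the CLASS of the pair of wavenumber GROUPS carrying the two factors, and its band
mean per class. In Fourier variables (Verma's mode-to-mode transfer `S(k|p|q)` = `ShellTransfer.modeTransfer û k p`, receiver `k`,
GIVER `p`, MEDIATOR `q = k − p`; the symmetrised Lamb pair `u_a × ω_c + u_c × ω_a` equals `−(u_a·∇)u_c − (u_c·∇)u_a` up to a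
gradient, which the Leray projector kills, so a symmetric class of group pairs `{A, C}` is 'giver in `A`, mediator in `C`' plus
'giver in `C`, mediator in `A`'), the band mean of a class is a `classTransfer`:

* `classTransfer û K P Q = Σ_{k∈K} Σ_{p∈P} [k − p ∈ Q] · S(k|p|k−p)` — energy per unit time INTO the modes `K` FROM givers in `P`
  through mediators in `Q` (§1). It is additive over disjoint unions in the giver set AND in the mediator set
  (`classTransfer_union_giver`, `classTransfer_union_mediator`), and when `Q` contains every mediator it is the plain shell
  transfer `T(P → K)` of the Literature file (`classTransfer_eq_shellTransfer_of_mediators`) — so a partition of (giver,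
  mediator) group pairs into classes splits `T(P → K)` EXACTLY into class transfers (`classTransfer_sum_partition`): the
  in-job check 'classes sum to the total' (printed to 1e-18).
* THE SWEEPING LEMMA (§2, `classTransfer_self_eq_zero`): if the mediator set `Q` is closed under `q ↦ −q` (every wavenumber
  shell / band / group is), then `classTransfer û K K Q = 0` — what the band's own modes hand to each other through
  mediators in `Q` nets to NOTHING over the band. Proof: Verma's antisymmetry `S(p|k|−q) = −S(k|p|q)`
  (`modeTransfer_antisymm`, incompressibility of the mediator + reality) and the swap `(k,p) ↦ (p,k)`, which maps the class
  to itself exactly when `Q = −Q`. COROLLARY (`strain_class_band_mean`): the instrument's STRAIN class for the target `K = G2`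
  against the larger scales `L = G0 ∪ G1` — the symmetric pair `{G2, L}` = (giver `L`, mediator `G2`) + (giver `G2`, mediator
  `L`) — has band mean equal to its FIRST half alone: the large scales GIVE energy to the band through band-scale mediators;
  the second half (band content advected / strained by the large scales: the part that MOVES and FOCUSES existing level-two
  maxima — the 'sweeping' of [cite: Verma2004MHDTurbulencePhysRep, §3.1]) is invisible in the band total and visible ONLY in
  the local density. This is the typed form of the instrument's question 'injection or re-organisation?': a site whose
  `|u_K|²` grows by the sweeping half grows at the expense of other sites of the same band.
* §3: the pointwise side in the abstract — for a finite family of real 'site densities' whose sum is zero, a positive value at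
  one site is paid for by the others (`exists_neg_of_sum_zero_of_pos`), and the logarithmic-rate bookkeeping the reader prints
  (`d ln q/dt = 2t/q` split additively over classes, `logRate_sum`).
Words: none. What is NOT here: Parseval (the identification of `classTransfer` with the band mean of the physical-space density
is the one of `ShellTransferParseval` for plain shell transfers and is not re-derived for classes), the Gaussian-filter flux, any
dynamics. 0 sorry; no named fact.
-/

noncomputable section

namespace Summit.NavierStokesRegularity.FluidComputer.TriadClassLedger

open Complex ComplexConjugate Finset
open scoped BigOperators
open Literature.Analysis.FluidPDE.FluidComputer.ShellTransfer

variable (U : FourierVelocity)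

/-! ## §1 Class transfers: receiver set, giver set, mediator set -/

/-- **Class transfer** INTO the modes `K` FROM givers `p ∈ P` through MEDIATORS `q = k − p ∈ Q`:
`Σ_{k∈K} Σ_{p∈P} [k − p ∈ Q] · S(k|p|k−p)`. With `Q` = everything it is the shell transfer `T(P → K)`. -/
def classTransfer (K P Q : Finset (Fin 3 → ℤ)) : ℝ :=
  ∑ k ∈ K, ∑ p ∈ P, if k - p ∈ Q then modeTransfer U k p else 0

/-- Additivity in the GIVER set over a disjoint union. -/
theorem classTransfer_union_giver (K P₁ P₂ Q : Finset (Fin 3 → ℤ)) (h : Disjoint P₁ P₂) :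
    classTransfer U K (P₁ ∪ P₂) Q = classTransfer U K P₁ Q + classTransfer U K P₂ Q := by
  unfold classTransfer
  rw [← Finset.sum_add_distrib]
  refine Finset.sum_congr rfl fun k _ => ?_
  rw [Finset.sum_union h]

/-- Additivity in the MEDIATOR set over a disjoint union. -/
theorem classTransfer_union_mediator (K P Q₁ Q₂ : Finset (Fin 3 → ℤ)) (h : Disjoint Q₁ Q₂) :
    classTransfer U K P (Q₁ ∪ Q₂) = classTransfer U K P Q₁ + classTransfer U K P Q₂ := by
  unfold classTransfer
  rw [← Finset.sum_add_distrib]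
  refine Finset.sum_congr rfl fun k _ => ?_
  rw [← Finset.sum_add_distrib]
  refine Finset.sum_congr rfl fun p _ => ?_
  by_cases h1 : k - p ∈ Q₁
  · have h2 : k - p ∉ Q₂ := Finset.disjoint_left.mp h h1
    simp [h1, h2]
  · by_cases h2 : k - p ∈ Q₂
    · simp [h1, h2]
    · simp [h1, h2]

/-- Additivity in the RECEIVER set over a disjoint union. -/
theorem classTransfer_union_receiver (K₁ K₂ P Q : Finset (Fin 3 → ℤ)) (h : Disjoint K₁ K₂) :
    classTransfer U (K₁ ∪ K₂) P Q = classTransfer U K₁ P Q + classTransfer U K₂ P Q := by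
  unfold classTransfer
  rw [Finset.sum_union h]

/-- An empty mediator class carries nothing. -/
theorem classTransfer_mediator_empty (K P : Finset (Fin 3 → ℤ)) : classTransfer U K P ∅ = 0 := by
  unfold classTransfer
  simp

/-- If `Q` contains EVERY mediator `k − p` (`k ∈ K`, `p ∈ P`), the class transfer is the plain shell transfer `T(P → K)`. -/
theorem classTransfer_eq_shellTransfer_of_mediators (K P Q : Finset (Fin 3 → ℤ))
    (hQ : ∀ k ∈ K, ∀ p ∈ P, k - p ∈ Q) : classTransfer U K P Q = shellTransfer U K P := by
  unfold classTransfer shellTransfer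
  refine Finset.sum_congr rfl fun k hk => ?_
  refine Finset.sum_congr rfl fun p hp => ?_
  rw [if_pos (hQ k hk p hp)]

/-- Mediators outside the reach of `K − P` do not matter: restricting `Q` to the mediators that occur changes nothing. -/
theorem classTransfer_congr_mediator (K P Q Q' : Finset (Fin 3 → ℤ))
    (hQ : ∀ k ∈ K, ∀ p ∈ P, (k - p ∈ Q ↔ k - p ∈ Q')) : classTransfer U K P Q = classTransfer U K P Q' := by
  unfold classTransfer
  refine Finset.sum_congr rfl fun k hk => ?_
  refine Finset.sum_congr rfl fun p hp => ?_
  exact if_congr (hQ k hk p hp) rfl rfl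

/-- **Classes sum to the total.** If the mediator classes `Q i` (`i ∈ s`) are pairwise disjoint and together contain every
mediator `k − p`, the class transfers add up to the shell transfer `T(P → K)` — the instrument's in-job identity
'inj + strain + self + back = total' for one giver set; combine with `classTransfer_union_giver` for giver classes. -/
theorem classTransfer_sum_partition {ι : Type*} (s : Finset ι) (Q : ι → Finset (Fin 3 → ℤ)) (K P : Finset (Fin 3 → ℤ))
    (hdisj : (s : Set ι).PairwiseDisjoint Q) (hcover : ∀ k ∈ K, ∀ p ∈ P, k - p ∈ s.biUnion Q) :
    ∑ i ∈ s, classTransfer U K P (Q i) = shellTransfer U K P := by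
  rw [← classTransfer_eq_shellTransfer_of_mediators U K P (s.biUnion Q) hcover]
  unfold classTransfer
  rw [Finset.sum_comm]
  refine Finset.sum_congr rfl fun k _ => ?_
  rw [Finset.sum_comm]
  refine Finset.sum_congr rfl fun p _ => ?_
  by_cases hm : k - p ∈ s.biUnion Q
  · rw [if_pos hm]
    obtain ⟨i, hi, hq⟩ := Finset.mem_biUnion.mp hm
    rw [Finset.sum_eq_single_of_mem i hi]
    · rw [if_pos hq]
    · intro j hj hji
      rw [if_neg]
      intro hqj
      exact (Finset.disjoint_left.mp (hdisj hj hi hji) hqj) hq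
  · rw [if_neg hm]
    refine Finset.sum_eq_zero fun i hi => ?_
    rw [if_neg]
    intro hq
    exact hm (Finset.mem_biUnion.mpr ⟨i, hi, hq⟩)

/-! ## §2 The sweeping lemma: a band hands itself nothing through a symmetric mediator set -/

/-- A set of wavevectors CLOSED UNDER NEGATION (`∀ q ∈ Q, −q ∈ Q`: every shell `a ≤ |q| < b`, every band, every group of the
instrument is) contains `q` iff it contains `−q`. -/
theorem negClosed_iff (Q : Finset (Fin 3 → ℤ)) (hQ : ∀ q ∈ Q, -q ∈ Q) (q : Fin 3 → ℤ) : q ∈ Q ↔ -q ∈ Q := by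
  refine ⟨hQ q, fun h => ?_⟩
  have := hQ (-q) h
  rwa [neg_neg] at this

/-- A set given by a condition on the squared length `Σ qᵢ²` (a shell, a band, a group) is closed under negation. -/
theorem negClosed_of_normSq (Q : Finset (Fin 3 → ℤ)) (c : ℤ → Prop)
    (hQ : ∀ q, q ∈ Q ↔ c (∑ i, q i * q i)) : ∀ q ∈ Q, -q ∈ Q := by
  intro q hq
  rw [hQ] at hq ⊢
  simpa using hq

/-- **THE SWEEPING LEMMA.** For a mediator set closed under negation, what the modes of `K` give to each other nets to zero
over `K`: `classTransfer û K K Q = 0`. (Verma's antisymmetry `S(p|k|·) = −S(k|p|·)` and the swap `(k, p) ↦ (p, k)`, under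
which the mediator flips sign.) -/
theorem classTransfer_self_eq_zero (K Q : Finset (Fin 3 → ℤ)) (hQ : ∀ q ∈ Q, -q ∈ Q) : classTransfer U K K Q = 0 := by
  have hswap : classTransfer U K K Q = -classTransfer U K K Q := by
    unfold classTransfer
    conv_lhs => rw [Finset.sum_comm]
    rw [← Finset.sum_neg_distrib]
    refine Finset.sum_congr rfl fun k _ => ?_
    rw [← Finset.sum_neg_distrib]
    refine Finset.sum_congr rfl fun p _ => ?_
    -- term (p, k) of the swapped sum vs term (k, p)
    have hmem : (p - k ∈ Q) ↔ (k - p ∈ Q) := by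
      rw [negClosed_iff Q hQ (p - k), neg_sub]
    by_cases h : k - p ∈ Q
    · rw [if_pos (hmem.mpr h), if_pos h, modeTransfer_antisymm]
    · rw [if_neg (fun h' => h (hmem.mp h')), if_neg h, neg_zero]
  linarith

/-- Without the indicator (all mediators allowed) this is the Literature file's `T(K → K) = 0`; recorded as the special case. -/
theorem classTransfer_self_univ (K Q : Finset (Fin 3 → ℤ)) (hQ : ∀ k ∈ K, ∀ p ∈ K, k - p ∈ Q) :
    classTransfer U K K Q = 0 := by
  rw [classTransfer_eq_shellTransfer_of_mediators U K K Q hQ, shellTransfer_self]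

/-- **THE STRAIN CLASS OF THE INSTRUMENT.** Target band `K`, larger scales `L` (disjoint from `K` or not — no hypothesis is
needed), both halves of the symmetric pair `{K, L}`: (giver `L`, mediator `K`) + (giver `K`, mediator `L`). If `L` is closed
under negation the band mean of the class is its FIRST half alone — the large scales give through band-scale mediators; the
sweeping half `classTransfer û K K L` is zero over the band. -/
theorem strain_class_band_mean (K L : Finset (Fin 3 → ℤ)) (hL : ∀ q ∈ L, -q ∈ L) :
    classTransfer U K L K + classTransfer U K K L = classTransfer U K L K := by
  rw [classTransfer_self_eq_zero U K L hL, add_zero]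

/-- The SELF class `(K, K)` (giver and mediator both in the band) also nets to zero over the band when `K = −K`:
the band total of the instrument's out2i ledger is carried by INJECTION `(L, L)`, the giving half of STRAIN, and BACKSCATTER. -/
theorem self_class_band_mean (K : Finset (Fin 3 → ℤ)) (hK : ∀ q ∈ K, -q ∈ K) : classTransfer U K K K = 0 :=
  classTransfer_self_eq_zero U K K hK

/-- **The band total in class form.** With the lattice split into the larger scales `L`, the band `K` and the smaller scales
`H` (pairwise disjoint, each closed under negation, together containing every mediator and every giver that occurs), the
energy rate of the band inside the truncated system `S = L ∪ K ∪ H` is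
`T(S → K) = [inj] T_{L,L} + [strain, giving half] T_{L|K} + [back] (everything with a factor in H)`,
the sweeping half of strain and the self class having dropped out. Stated as: total = inj + strain(giving) + back terms. -/
theorem band_total_class_form (K L H : Finset (Fin 3 → ℤ)) (hL : ∀ q ∈ L, -q ∈ L) (hK : ∀ q ∈ K, -q ∈ K)
    (hLK : Disjoint L K) (hLH : Disjoint L H) (hKH : Disjoint K H)
    (hcover : ∀ k ∈ K, ∀ p ∈ L ∪ K ∪ H, k - p ∈ L ∪ K ∪ H) :
    shellTransfer U K (L ∪ K ∪ H) =
      classTransfer U K L L + classTransfer U K L K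
        + (classTransfer U K L H + classTransfer U K K H + classTransfer U K H (L ∪ K ∪ H)) := by
  have hLK' : Disjoint (L ∪ K) H := Finset.disjoint_union_left.mpr ⟨hLH, hKH⟩
  rw [← classTransfer_eq_shellTransfer_of_mediators U K (L ∪ K ∪ H) (L ∪ K ∪ H) hcover,
    classTransfer_union_giver U K (L ∪ K) H _ hLK', classTransfer_union_giver U K L K _ hLK,
    classTransfer_union_mediator U K L (L ∪ K) H hLK', classTransfer_union_mediator U K L L K hLK,
    classTransfer_union_mediator U K K (L ∪ K) H hLK', classTransfer_union_mediator U K K L K hLK,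
    classTransfer_self_eq_zero U K L hL, classTransfer_self_eq_zero U K K hK]
  ring

/-! ## §3 The pointwise side, abstractly: a zero-sum class is a transfer BETWEEN sites; logarithmic rates add over classes -/

/-- If finitely many real site-densities sum to zero and one of them is positive, another is negative: a site that grows by a
zero-net class grows at the expense of other sites of the same band. -/
theorem exists_neg_of_sum_zero_of_pos {ι : Type*} (s : Finset ι) (f : ι → ℝ) (hs : ∑ i ∈ s, f i = 0)
    {i₀ : ι} (hi₀ : i₀ ∈ s) (hpos : 0 < f i₀) : ∃ j ∈ s, f j < 0 := by
  by_contra hcon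
  push Not at hcon
  have hle : f i₀ ≤ ∑ i ∈ s, f i := Finset.single_le_sum (fun j hj => hcon j hj) hi₀
  linarith

/-- The reader's logarithmic rate: for `q > 0` and `dq/dt = 2 (Σ classes t_c)`, `d ln q/dt = Σ_c (2 t_c / q)` — the class
log-rates printed per site ADD to the site's log-rate. (Pure algebra of the printed columns.) -/
theorem logRate_sum {ι : Type*} (s : Finset ι) (t : ι → ℝ) (q : ℝ) :
    2 * (∑ c ∈ s, t c) / q = ∑ c ∈ s, 2 * t c / q := by
  rw [Finset.mul_sum, Finset.sum_div]

/-- … and `HasDerivAt (log ∘ q) ((dq/dt)/q)` for a positive differentiable `q`: the column `dlnq_dt = 2 t / q` IS the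
derivative of `ln q` when `dq/dt = 2t` (envelope bookkeeping at a fixed grid site; the site itself may hop — the reader's
takeover ledger tracks that separately). -/
theorem hasDerivAt_log_site {q : ℝ → ℝ} {q' x : ℝ} (hq : HasDerivAt q q' x) (hpos : 0 < q x) :
    HasDerivAt (fun s => Real.log (q s)) (q' / q x) x :=
  hq.log hpos.ne'

/-! ## §4 The envelope over finitely many sites: the band sup moves no faster than its fastest site (takeover bookkeeping) -/

/-- Over a finite nonempty set of sites, the increment of the MAXIMUM between two instants is at most the largest site increment:
`max_i q'(i) − max_i q(i) ≤ max_i (q'(i) − q(i))`. (The new argmax `j` has `q(j) ≤ max q`.) -/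
theorem sup_increment_le {ι : Type*} (s : Finset ι) (hs : s.Nonempty) (q q' : ι → ℝ) :
    s.sup' hs q' - s.sup' hs q ≤ s.sup' hs (fun i => q' i - q i) := by
  obtain ⟨j, hj, hjmax⟩ := Finset.exists_mem_eq_sup' hs q'
  rw [hjmax]
  have h1 : q j ≤ s.sup' hs q := Finset.le_sup' q hj
  have h2 : q' j - q j ≤ s.sup' hs (fun i => q' i - q i) := Finset.le_sup' (fun i => q' i - q i) hj
  linarith

/-- … and at least the increment of the INCUMBENT (any site that carried the maximum at the first instant):
`q'(i₀) − q(i₀) ≤ max q' − max q` when `q(i₀) = max q`. -/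
theorem incumbent_increment_le {ι : Type*} (s : Finset ι) (hs : s.Nonempty) (q q' : ι → ℝ) {i₀ : ι} (hi₀ : i₀ ∈ s)
    (hinc : q i₀ = s.sup' hs q) : q' i₀ - q i₀ ≤ s.sup' hs q' - s.sup' hs q := by
  have h1 : q' i₀ ≤ s.sup' hs q' := Finset.le_sup' q' hi₀
  linarith

/-- **TAKEOVER IN ONE LINE.** If the maximum ROSE between the two instants while the incumbent's own value FELL, then some OTHER
site rose by at least the rise of the maximum — the winner is a different site (what the reader's argmax-hop detector records). -/
theorem exists_other_site_of_rise {ι : Type*} (s : Finset ι) (hs : s.Nonempty) (q q' : ι → ℝ) {i₀ : ι}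
    (hinc : q i₀ = s.sup' hs q) (hrise : s.sup' hs q < s.sup' hs q') (hfall : q' i₀ ≤ q i₀) :
    ∃ j ∈ s, j ≠ i₀ ∧ s.sup' hs q' - s.sup' hs q ≤ q' j - q j := by
  obtain ⟨j, hj, hjmax⟩ := Finset.exists_mem_eq_sup' hs q'
  refine ⟨j, hj, ?_, ?_⟩
  · rintro rfl
    rw [hjmax] at hrise
    linarith
  · have h1 : q j ≤ s.sup' hs q := Finset.le_sup' q hj
    rw [hjmax]; linarith

/-- Logarithmic form used by the reader (values positive): the log of the maximum rises by at most the largest site log-increment,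
so a band whose sup e-folds at rate `a` over a window has, at each step, SOME site e-folding at rate `≥ a` over that step. -/
theorem log_sup_increment_le {ι : Type*} (s : Finset ι) (hs : s.Nonempty) (q q' : ι → ℝ) (hq : ∀ i ∈ s, 0 < q i) :
    Real.log (s.sup' hs q') - Real.log (s.sup' hs q) ≤ s.sup' hs (fun i => Real.log (q' i) - Real.log (q i)) := by
  obtain ⟨j, hj, hjmax⟩ := Finset.exists_mem_eq_sup' hs q'
  have h1 : Real.log (q j) ≤ Real.log (s.sup' hs q) := Real.log_le_log (hq j hj) (Finset.le_sup' q hj)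
  have h2 : Real.log (q' j) - Real.log (q j) ≤ s.sup' hs (fun i => Real.log (q' i) - Real.log (q i)) :=
    Finset.le_sup' (fun i => Real.log (q' i) - Real.log (q i)) hj
  rw [hjmax]; linarith

/-! ## §5 The record of the local transfer read (three relay designs, 128³; HOME/atlas/rung-next/p1/spatial/transfer/; kit j254650–j254652 +
material pass j254888 / j254916 / j254889; deposit README (X1)–(X4)) — numbers PRINTED by the readers (128³ lattice); words none -/

/-- The three relay designs read: `0` = u0_b⁽²⁾ (ν₀/3, re-ascent), `1` = design (b) u0_b (ν₀/3), `2` = the Euler control u0_bE (ν = 0). -/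
abbrev Design := Fin 3

/-- Half a wavelength of the level-two band's lower edge, `ℓ₂/2 = π/9` (box 2π, band [9,17)): the takeover detector's hop threshold. -/
def halfEll2 : ℝ := Real.pi / 9

/-- `0.349 < π/9 < 0.3491`. -/
theorem halfEll2_bounds : 0.349 < halfEll2 ∧ halfEll2 < 0.3491 := by
  unfold halfEll2
  constructor
  · have := Real.pi_gt_d4; linarith
  · have := Real.pi_lt_d4; linarith

/-- TAKEOVER instants: in all three designs the [9,17) ω-argmax hop is detected between the SAME two row instants. -/
def takeoverFrom : Design → ℝ := ![2.00, 2.00, 2.00]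
/-- … and the instant at which the hop is complete. -/
def takeoverTo : Design → ℝ := ![2.05, 2.05, 2.05]
/-- hop length of the ω-argmax (box units). -/
def takeoverJump : Design → ℝ := ![0.874, 0.743, 0.710]
/-- distance of the WINNER site to the [5,9) ω-argmax of the same instant. -/
def winnerToParent : Design → ℝ := ![0.286, 0.208, 0.264]
/-- distance of the [5,9) ω-argmax to the (future) winner site half a time unit BEFORE the takeover … -/
def parentApproachBefore : Design → ℝ := ![0.473, 0.445, 0.503]
/-- … and 0.3 AFTER it (the parent maximum moves off). -/
def parentAfter : Design → ℝ := ![0.798, 0.882, 0.964]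
/-- W_out2i half a unit after the hop over W just before it. -/
def winnerRatio : Design → ℝ := ![1.774, 1.810, 1.751]

/-- **THE TAKEOVER IS GENERIC** (gen 15's open question): same instants in all three designs, every hop exceeds ℓ₂/2, every winner is born
within ℓ₂/2 of the level-one maximum, which was ≥ 0.44 away half a unit earlier and is ≥ 0.79 away 0.3 later, and the three W-ratios
agree to within 4 %. -/
theorem takeover_generic :
    (∀ d, takeoverFrom d = 2 ∧ takeoverTo d = 2.05) ∧ (∀ d, halfEll2 < takeoverJump d) ∧ (∀ d, winnerToParent d < halfEll2) ∧
    (∀ d, 0.44 ≤ parentApproachBefore d ∧ 0.79 ≤ parentAfter d) ∧ (∀ d d', winnerRatio d ≤ 1.04 * winnerRatio d') := by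
  have h := halfEll2_bounds
  refine ⟨fun d => ?_, fun d => ?_, fun d => ?_, fun d => ?_, fun d d' => ?_⟩
  · fin_cases d <;> simp [takeoverFrom, takeoverTo] <;> norm_num
  · fin_cases d <;> simp [takeoverJump] <;> linarith
  · fin_cases d <;> simp [winnerToParent] <;> linarith
  · fin_cases d <;> simp [parentApproachBefore, parentAfter] <;> norm_num
  · fin_cases d <;> fin_cases d' <;> simp [winnerRatio] <;> norm_num

/-- CLASS SHARES of the time-integrated level-two feed `∫T₂ dt` over the TROUGH window [0.4, 2.0): (injection, strain-giving, self, back). The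
self column is the in-job numerical face of `self_class_band_mean` (exactly 0 in the algebra; O(1e-18) of the total in float64). -/
def troughShares : Design → Fin 4 → ℝ := ![![1.303, 0.033, 0, -0.336], ![1.300, 0.035, 0, -0.335], ![1.377, 0.042, 0, -0.420]]
/-- … and over the PULSE window [takeover, t₂ + 0.1]. -/
def pulseShares : Design → Fin 4 → ℝ := ![![1.514, 0.330, 0, -0.844], ![1.545, 0.328, 0, -0.874], ![2.463, 0.614, 0, -2.077]]

/-- **THE TROUGH IS FED BY INJECTION.** In every design the level-two band's net nonlinear feed through the trough is INJECTION (pairs with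
both factors below |n| = 9) to more than 100 % (backscatter to |n| ≥ 17 is a drain), the strain-giving class (large scales giving through
band-scale mediators — the textbook local cascade step) is ≤ 5 % of the net, and the self class is zero; in the pulse the strain-giving
share rises to 0.2–0.4 of injection while the drain to smaller scales grows. -/
theorem trough_fed_by_injection :
    (∀ d, 1.25 ≤ troughShares d 0 ∧ troughShares d 1 ≤ 0.05 ∧ troughShares d 2 = 0 ∧ troughShares d 3 < 0) ∧
    (∀ d, 0.2 * pulseShares d 0 ≤ pulseShares d 1 ∧ pulseShares d 1 ≤ 0.4 * pulseShares d 0 ∧ pulseShares d 3 < troughShares d 3) := by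
  constructor
  · intro d; fin_cases d <;> simp [troughShares] <;> norm_num
  · intro d; fin_cases d <;> simp [pulseShares, troughShares] <;> norm_num

/-- WHERE THE INJECTION DENSITY PEAKS (window means of the distance of its sup): to the [9,17) ω-argmax in the TROUGH vs in the PULSE,
and to the [5,9) ω-argmax in the trough. -/
def injToLevelTwoTrough : Design → ℝ := ![0.469, 0.477, 0.562]
/-- distance of the injection-density sup to the [9,17) ω-argmax, PULSE window mean. -/
def injToLevelTwoPulse : Design → ℝ := ![0.177, 0.175, 0.206]
/-- distance of the injection-density sup to the [5,9) ω-argmax, TROUGH window mean. -/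
def injToParentTrough : Design → ℝ := ![0.686, 0.691, 0.637]

/-- **NOT CO-LOCATED IN THE TROUGH, CO-LOCATED IN THE PULSE.** Through the trough the injection density has its sup MORE than ℓ₂/2 from the
structure carrying the level-two sup (and within 0.7 ≈ ℓ₁/2 + h of the level-one maximum); in the pulse it sits WITHIN ℓ₂/2 of the
winner — the (h3) GENERATION handle of the LEAD NOTE in measured form. -/
theorem injection_colocates_only_in_pulse :
    (∀ d, halfEll2 < injToLevelTwoTrough d ∧ injToLevelTwoPulse d < halfEll2) ∧ (∀ d, injToParentTrough d ≤ 0.7) := by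
  have h := halfEll2_bounds
  constructor
  · intro d; fin_cases d <;> simp [injToLevelTwoTrough, injToLevelTwoPulse] <;> constructor <;> linarith
  · intro d; fin_cases d <;> simp [injToParentTrough] <;> norm_num

/-- (X2) THE PULSE IN THE (b)-HANDLE CURRENCY AT THE WINNER SITE: band trough `φ₂,min`, the winner's site coherence when it first enters the
top-3 maxima (`φ_site = |u_out2i|` at the structure's own u-maximum over the kinematic ceiling), and the band peak `φ₂(t₂)` (carried by the
winner: `φ_site/φ₂ = 1` from the hop to `t₂`). -/
def bandTrough : Design → ℝ := ![0.0852, 0.0847, 0.0798]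
/-- the winner's site coherence at the instant it first enters the top-3 separated ω-maxima. -/
def winnerFirstSeen : Design → ℝ := ![0.1015, 0.1067, 0.0911]
/-- the band coherence peak `φ₂(t₂)` (carried by the winner). -/
def bandPeak : Design → ℝ := ![0.1835, 0.1873, 0.1962]

/-- hand-over factor (trough → the winner's birth value) and the winner's own growth factor; their product is the pulse ratio. -/
def handoverFactor (d : Design) : ℝ := winnerFirstSeen d / bandTrough d
/-- the winner's own growth factor from its birth value to the band peak. -/
def ownGrowthFactor (d : Design) : ℝ := bandPeak d / winnerFirstSeen d

/-- pulse ratio = hand-over factor × own-growth factor (exact arithmetic of the three printed numbers). -/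
theorem pulse_ratio_factorises (d : Design) : bandPeak d / bandTrough d = handoverFactor d * ownGrowthFactor d := by
  have h1 : bandTrough d ≠ 0 := by fin_cases d <;> simp [bandTrough] <;> norm_num
  have h2 : winnerFirstSeen d ≠ 0 := by fin_cases d <;> simp [winnerFirstSeen] <;> norm_num
  unfold handoverFactor ownGrowthFactor
  field_simp

/-- **CHANGE OF CARRIER IS THE SMALLER PART.** In every design the winner is born ABOVE the band trough (hand-over factor in (1.14, 1.27)),
its own growth is the larger factor (in (1.75, 2.16)), and the hand-over carries less than a third of the pulse in logarithms
(`handover³ < pulse ratio`). -/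
theorem handover_is_minor_part :
    (∀ d, 1.14 < handoverFactor d ∧ handoverFactor d < 1.27) ∧ (∀ d, 1.75 < ownGrowthFactor d ∧ ownGrowthFactor d < 2.16) ∧
    (∀ d, handoverFactor d ^ 3 < bandPeak d / bandTrough d) := by
  refine ⟨fun d => ?_, fun d => ?_, fun d => ?_⟩
  · fin_cases d <;> simp [handoverFactor, winnerFirstSeen, bandTrough] <;> norm_num
  · fin_cases d <;> simp [ownGrowthFactor, winnerFirstSeen, bandPeak] <;> norm_num
  · fin_cases d <;> simp [handoverFactor, winnerFirstSeen, bandTrough, bandPeak] <;> norm_num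

/-! ## §6 Citation note (lit g53, HOME/STATUS l.5392 (i); wording only). The antisymmetry behind `classTransfer_self_eq_zero` is
[cite: Verma2004MHDTurbulencePhysRep, §3.1], which prints 'mediator' for `q = k − p` and never 'sweeping'; the printed home of 'SWEEPING'
as used in this file's docstrings (advection of small-scale content by the energetic low wavenumbers — large pointwise, cancelling in the band
mean) is Kraichnan 1966 §3 as quoted and analysed in [cite: AluieEyink2009, §II; pp. 6, 12–13]. Read 'sweeping' above with that attribution. -/

end Summit.NavierStokesRegularity.FluidComputer.TriadClassLedger

end
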